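import Summits.Ventures.PercRepro.C041TriDomExcessZeroSide

/-!
# ROW C-041 — THE EQUALITY CASE OF THE EXCESS, II: THE SIDE FLIP; SEPARABLE HOSTS HAVE EXCESS ZERO
(p6, gen 43; P6-TWOEXIT-LEAN.md §53 ADDENDUM 2, the kernel half `(⇐)`, part II of II)

On part I (`C041TriDomExcessZeroSide`: present edges, `side`, `SepS`, `SeparableS`, the walk lemmas `rtg_out` /
`rtg_in` / `rtg_through`).

* A MARK SEPARATES THE OTHER TWO (`esym_eq_zero_of_sep_anchor`, for the anchor): THE SIDE FLIP `flipT` complements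
  the colours of the edges touching the far side `C = side st a₁ u'`.  The flip keeps `a₁ ~ u` (`u ∉ C`), exchanges
  the colour of `a₁ ~ u'` (`u' ∈ C`), and the third coordinate of each pattern is the conjunction of the first two
  (`rsig_sep`, `bsig_sep`).  Pointwise `Fsym s t + Fsym s̃ t̃ = 0` for the flipped pair (`Fsym_sep_flip`, a `decide`
  over `Bool⁴`), and the flip is an involution of the colourings, so `2 esym = 0`.  Coincident marks contribute `0`
  pointwise (`Fsym_zero_coinc_first`, `Fsym_zero_coinc_second`).
* The two other separations follow by the relabelling symmetries of `esym` (`esym_aswap`, `esym_eswap`, `esym_rot`,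
  three `decide`s on `Fsym`): **`esym_eq_zero_of_separable`** for every status, and for the all-free status the tree's
  excess: **`excess_eq_zero_of_separable : SeparableS … → excess Z₁ u u' a₁ = 0`**.
* The converse (a connected non-separable host has `e ≥ 1`, by a cycle-or-tripod minor) is the paper half of
  ADDENDUM 2 and is NOT claimed here.
-/

namespace PercRepro

namespace ZoneZ

namespace MultiExit

open ZoneData Finset

variable {V₁ E₁ U₁ U₂ : Type} (Z₁ : ZoneData V₁ E₁ U₁ U₂) (u u' a₁ : V₁)

variable [DecidableEq E₁] [Fintype E₁]

/-! ## The adjacencies under the side flip -/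

omit [DecidableEq E₁] [Fintype E₁] in
/-- Outside `C` the red adjacency is unchanged by the flip. -/
theorem AdjColOut_red_flipT (st : E₁ → EStat) (C : Set V₁) (ω : E₁ → Bool) :
    AdjColOut Z₁ C (redE st (flipT Z₁ C ω)) = AdjColOut Z₁ C (redE st ω) := by
  funext x y
  refine propext (exists_congr fun e => ?_)
  constructor
  · rintro ⟨hj, hr, hn⟩; exact ⟨hj, (redE_flipT_of_not_touches Z₁ st C ω hn).1 hr, hn⟩
  · rintro ⟨hj, hr, hn⟩; exact ⟨hj, (redE_flipT_of_not_touches Z₁ st C ω hn).2 hr, hn⟩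

omit [DecidableEq E₁] [Fintype E₁] in
/-- Outside `C` the blue adjacency is unchanged by the flip. -/
theorem AdjColOut_blue_flipT (st : E₁ → EStat) (C : Set V₁) (ω : E₁ → Bool) :
    AdjColOut Z₁ C (blueE st (flipT Z₁ C ω)) = AdjColOut Z₁ C (blueE st ω) := by
  funext x y
  refine propext (exists_congr fun e => ?_)
  constructor
  · rintro ⟨hj, hr, hn⟩; exact ⟨hj, (blueE_flipT_of_not_touches Z₁ st C ω hn).1 hr, hn⟩
  · rintro ⟨hj, hr, hn⟩; exact ⟨hj, (blueE_flipT_of_not_touches Z₁ st C ω hn).2 hr, hn⟩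

omit [DecidableEq E₁] [Fintype E₁] in
/-- Into `C` the red adjacency after the flip is the blue adjacency before. -/
theorem AdjColIn_red_flipT (st : E₁ → EStat) (C : Set V₁) (ω : E₁ → Bool) :
    AdjColIn Z₁ C (redE st (flipT Z₁ C ω)) = AdjColIn Z₁ C (blueE st ω) := by
  funext x y
  refine propext (exists_congr fun e => ?_)
  constructor
  · rintro ⟨hj, hr, ht⟩; exact ⟨hj, (redE_flipT_of_touches Z₁ st C ω ht).1 hr, ht⟩
  · rintro ⟨hj, hr, ht⟩; exact ⟨hj, (redE_flipT_of_touches Z₁ st C ω ht).2 hr, ht⟩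

omit [DecidableEq E₁] [Fintype E₁] in
/-- Into `C` the blue adjacency after the flip is the red adjacency before. -/
theorem AdjColIn_blue_flipT (st : E₁ → EStat) (C : Set V₁) (ω : E₁ → Bool) :
    AdjColIn Z₁ C (blueE st (flipT Z₁ C ω)) = AdjColIn Z₁ C (redE st ω) := by
  funext x y
  refine propext (exists_congr fun e => ?_)
  constructor
  · rintro ⟨hj, hr, ht⟩; exact ⟨hj, (blueE_flipT_of_touches Z₁ st C ω ht).1 hr, ht⟩
  · rintro ⟨hj, hr, ht⟩; exact ⟨hj, (blueE_flipT_of_touches Z₁ st C ω ht).2 hr, ht⟩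

/-! ## The pattern coordinates under the side flip (the anchor separates the exits) -/

omit [DecidableEq E₁] [Fintype E₁] in
/-- Red connectivity from `k` is the reflexive–transitive closure of the red adjacency. -/
theorem RdS_iff_rtg (st : E₁ → EStat) (ω : E₁ → Bool) (k v : V₁) :
    RdS Z₁ st ω k v ↔ Relation.ReflTransGen (AdjCol Z₁ (redE st ω)) k v := by
  unfold RdS
  rw [mem_reach_singleton, RAdjS_eq_AdjCol]

omit [DecidableEq E₁] [Fintype E₁] in
/-- Blue connectivity from `k` is the reflexive–transitive closure of the blue adjacency. -/
theorem MgS_iff_rtg (st : E₁ → EStat) (ω : E₁ → Bool) (k v : V₁) :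
    MgS Z₁ st ω k v ↔ Relation.ReflTransGen (AdjCol Z₁ (blueE st ω)) k v := by
  unfold MgS
  rw [mem_reach_singleton, BAdjS_eq_AdjCol]

omit [DecidableEq E₁] [Fintype E₁] in
/-- The flip keeps red connectivity from `a₁` to the near exit `u ∉ C`. -/
theorem RdS_flipT_near {st : E₁ → EStat} (hu' : u' ≠ a₁) (hu : u ∉ side Z₁ st a₁ u') (ω : E₁ → Bool) :
    RdS Z₁ st (flipT Z₁ (side Z₁ st a₁ u') ω) a₁ u ↔ RdS Z₁ st ω a₁ u := by
  rw [RdS_iff_rtg, RdS_iff_rtg, rtg_iff_out Z₁ hu' (fun _ he => redE_pres he) hu,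
    rtg_iff_out Z₁ hu' (fun _ he => redE_pres he) hu, AdjColOut_red_flipT]

omit [DecidableEq E₁] [Fintype E₁] in
/-- The flip keeps blue connectivity from `a₁` to the near exit `u ∉ C`. -/
theorem MgS_flipT_near {st : E₁ → EStat} (hu' : u' ≠ a₁) (hu : u ∉ side Z₁ st a₁ u') (ω : E₁ → Bool) :
    MgS Z₁ st (flipT Z₁ (side Z₁ st a₁ u') ω) a₁ u ↔ MgS Z₁ st ω a₁ u := by
  rw [MgS_iff_rtg, MgS_iff_rtg, rtg_iff_out Z₁ hu' (fun _ he => blueE_pres he) hu,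
    rtg_iff_out Z₁ hu' (fun _ he => blueE_pres he) hu, AdjColOut_blue_flipT]

omit [DecidableEq E₁] [Fintype E₁] in
/-- The far exit `u'` lies on its own side. -/
theorem mem_side_self (st : E₁ → EStat) (a c : V₁) : c ∈ side Z₁ st a c := mem_reach_self _ _

omit [DecidableEq E₁] [Fintype E₁] in
/-- After the flip, red connectivity from `a₁` to the far exit `u'` is blue connectivity before. -/
theorem RdS_flipT_far {st : E₁ → EStat} (hu' : u' ≠ a₁) (ω : E₁ → Bool) :
    RdS Z₁ st (flipT Z₁ (side Z₁ st a₁ u') ω) a₁ u' ↔ MgS Z₁ st ω a₁ u' := by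
  rw [RdS_iff_rtg, MgS_iff_rtg, rtg_iff_in Z₁ hu' (fun _ he => redE_pres he) (mem_side_self Z₁ st a₁ u'),
    rtg_iff_in Z₁ hu' (fun _ he => blueE_pres he) (mem_side_self Z₁ st a₁ u'), AdjColIn_red_flipT]

omit [DecidableEq E₁] [Fintype E₁] in
/-- After the flip, blue connectivity from `a₁` to the far exit `u'` is red connectivity before. -/
theorem MgS_flipT_far {st : E₁ → EStat} (hu' : u' ≠ a₁) (ω : E₁ → Bool) :
    MgS Z₁ st (flipT Z₁ (side Z₁ st a₁ u') ω) a₁ u' ↔ RdS Z₁ st ω a₁ u' := by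
  rw [RdS_iff_rtg, MgS_iff_rtg, rtg_iff_in Z₁ hu' (fun _ he => blueE_pres he) (mem_side_self Z₁ st a₁ u'),
    rtg_iff_in Z₁ hu' (fun _ he => redE_pres he) (mem_side_self Z₁ st a₁ u'), AdjColIn_blue_flipT]

omit [DecidableEq E₁] [Fintype E₁] in
/-- Red connectivity between the exits passes through the separating anchor. -/
theorem RdS_exits_iff {st : E₁ → EStat} (hu' : u' ≠ a₁) (hu : u ∉ side Z₁ st a₁ u') (ω : E₁ → Bool) :
    RdS Z₁ st ω u u' ↔ (RdS Z₁ st ω a₁ u ∧ RdS Z₁ st ω a₁ u') := by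
  constructor
  · intro h
    rw [RdS_iff_rtg] at h
    obtain ⟨h1, h2⟩ := rtg_through Z₁ hu' (fun _ he => redE_pres he) hu h (mem_side_self Z₁ st a₁ u')
    exact ⟨RdS_symm Z₁ st ω ((RdS_iff_rtg Z₁ st ω u a₁).2 h1), (RdS_iff_rtg Z₁ st ω a₁ u').2 h2⟩
  · rintro ⟨h1, h2⟩
    exact reach_trans' (RdS_symm Z₁ st ω h1) h2

omit [DecidableEq E₁] [Fintype E₁] in
/-- Blue connectivity between the exits passes through the separating anchor. -/
theorem MgS_exits_iff {st : E₁ → EStat} (hu' : u' ≠ a₁) (hu : u ∉ side Z₁ st a₁ u') (ω : E₁ → Bool) :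
    MgS Z₁ st ω u u' ↔ (MgS Z₁ st ω a₁ u ∧ MgS Z₁ st ω a₁ u') := by
  constructor
  · intro h
    rw [MgS_iff_rtg] at h
    obtain ⟨h1, h2⟩ := rtg_through Z₁ hu' (fun _ he => blueE_pres he) hu h (mem_side_self Z₁ st a₁ u')
    exact ⟨MgS_symm Z₁ st ω ((MgS_iff_rtg Z₁ st ω u a₁).2 h1), (MgS_iff_rtg Z₁ st ω a₁ u').2 h2⟩
  · rintro ⟨h1, h2⟩
    exact reach_trans' (MgS_symm Z₁ st ω h1) h2

omit [DecidableEq E₁] [Fintype E₁] in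
open Classical in
/-- The red pattern when the anchor separates the exits: `(p, q, p ∧ q)`. -/
theorem rsig_sep {st : E₁ → EStat} (hu' : u' ≠ a₁) (hu : u ∉ side Z₁ st a₁ u') (ω : E₁ → Bool) :
    rsig Z₁ u u' a₁ st ω = (decide (RdS Z₁ st ω a₁ u), decide (RdS Z₁ st ω a₁ u'),
      decide (RdS Z₁ st ω a₁ u) && decide (RdS Z₁ st ω a₁ u')) := by
  have h3 := RdS_exits_iff Z₁ u u' a₁ hu' hu ω
  simp only [rsig, Prod.mk.injEq, true_and]
  by_cases hp : RdS Z₁ st ω a₁ u <;> by_cases hq : RdS Z₁ st ω a₁ u'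
  · rw [decide_eq_true (h3.2 ⟨hp, hq⟩), decide_eq_true hp, decide_eq_true hq]
    rfl
  · rw [decide_eq_false (fun h => hq (h3.1 h).2), decide_eq_true hp, decide_eq_false hq]
    rfl
  · rw [decide_eq_false (fun h => hp (h3.1 h).1), decide_eq_false hp, decide_eq_true hq]
    rfl
  · rw [decide_eq_false (fun h => hp (h3.1 h).1), decide_eq_false hp, decide_eq_false hq]
    rfl

omit [DecidableEq E₁] [Fintype E₁] in
open Classical in
/-- The blue pattern when the anchor separates the exits: `(p', q', p' ∧ q')`. -/
theorem bsig_sep {st : E₁ → EStat} (hu' : u' ≠ a₁) (hu : u ∉ side Z₁ st a₁ u') (ω : E₁ → Bool) :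
    bsig Z₁ u u' a₁ st ω = (decide (MgS Z₁ st ω a₁ u), decide (MgS Z₁ st ω a₁ u'),
      decide (MgS Z₁ st ω a₁ u) && decide (MgS Z₁ st ω a₁ u')) := by
  have h3 := MgS_exits_iff Z₁ u u' a₁ hu' hu ω
  simp only [bsig, Prod.mk.injEq, true_and]
  by_cases hp : MgS Z₁ st ω a₁ u <;> by_cases hq : MgS Z₁ st ω a₁ u'
  · rw [decide_eq_true (h3.2 ⟨hp, hq⟩), decide_eq_true hp, decide_eq_true hq]
    rfl
  · rw [decide_eq_false (fun h => hq (h3.1 h).2), decide_eq_true hp, decide_eq_false hq]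
    rfl
  · rw [decide_eq_false (fun h => hp (h3.1 h).1), decide_eq_false hp, decide_eq_true hq]
    rfl
  · rw [decide_eq_false (fun h => hp (h3.1 h).1), decide_eq_false hp, decide_eq_false hq]
    rfl

/-- THE FLIP IDENTITY: the flipped pair of patterns cancels the original pair. -/
theorem Fsym_sep_flip : ∀ p q p' q' : Bool,
    Fsym (p, q, p && q) (p', q', p' && q') + Fsym (p, q', p && q') (p', q, p' && q) = 0 := by
  decide

omit [DecidableEq E₁] [Fintype E₁] in
open Classical in
/-- Pointwise, a colouring and its side flip contribute `0` together. -/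
theorem Fsym_add_flipT {st : E₁ → EStat} (hu' : u' ≠ a₁) (hu : u ∉ side Z₁ st a₁ u') (ω : E₁ → Bool) :
    Fsym (rsig Z₁ u u' a₁ st ω) (bsig Z₁ u u' a₁ st ω)
      + Fsym (rsig Z₁ u u' a₁ st (flipT Z₁ (side Z₁ st a₁ u') ω))
          (bsig Z₁ u u' a₁ st (flipT Z₁ (side Z₁ st a₁ u') ω)) = 0 := by
  rw [rsig_sep Z₁ u u' a₁ hu' hu ω, bsig_sep Z₁ u u' a₁ hu' hu ω, rsig_sep Z₁ u u' a₁ hu' hu,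
    bsig_sep Z₁ u u' a₁ hu' hu]
  have h1 : decide (RdS Z₁ st (flipT Z₁ (side Z₁ st a₁ u') ω) a₁ u) = decide (RdS Z₁ st ω a₁ u) :=
    decide_eq_decide.2 (RdS_flipT_near Z₁ u u' a₁ hu' hu ω)
  have h2 : decide (RdS Z₁ st (flipT Z₁ (side Z₁ st a₁ u') ω) a₁ u') = decide (MgS Z₁ st ω a₁ u') :=
    decide_eq_decide.2 (RdS_flipT_far Z₁ u' a₁ hu' ω)
  have h3 : decide (MgS Z₁ st (flipT Z₁ (side Z₁ st a₁ u') ω) a₁ u) = decide (MgS Z₁ st ω a₁ u) :=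
    decide_eq_decide.2 (MgS_flipT_near Z₁ u u' a₁ hu' hu ω)
  have h4 : decide (MgS Z₁ st (flipT Z₁ (side Z₁ st a₁ u') ω) a₁ u') = decide (RdS Z₁ st ω a₁ u') :=
    decide_eq_decide.2 (MgS_flipT_far Z₁ u' a₁ hu' ω)
  rw [h1, h2, h3, h4]
  exact Fsym_sep_flip _ _ _ _

/-- Coincident anchor and first exit: `Fsym` vanishes. -/
theorem Fsym_zero_coinc_first : ∀ s t : P3, s.1 = true → t.1 = true → Fsym s t = 0 := by
  decide

/-- Coincident anchor and second exit: `Fsym` vanishes. -/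
theorem Fsym_zero_coinc_second : ∀ s t : P3, s.2.1 = true → t.2.1 = true → Fsym s t = 0 := by
  decide

open Classical in
/-- **THE ANCHOR SEPARATES THE EXITS ⟹ `esym = 0`** (the side flip is an involution of the colourings). -/
theorem esym_eq_zero_of_sep_anchor (st : E₁ → EStat) (h : SepS Z₁ st a₁ u u') : esym Z₁ u u' a₁ st = 0 := by
  rcases h with h | h | h
  · -- `u = a₁`
    subst h
    unfold esym
    refine Finset.sum_eq_zero fun ω _ => Fsym_zero_coinc_first _ _ ?_ ?_
    · rw [rsig_fst]; exact decide_eq_true (mem_reach_self _ _)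
    · rw [bsig_fst]; exact decide_eq_true (mem_reach_self _ _)
  · -- `u' = a₁`
    subst h
    unfold esym
    refine Finset.sum_eq_zero fun ω _ => Fsym_zero_coinc_second _ _ ?_ ?_
    · rw [rsig_snd]; exact decide_eq_true (mem_reach_self _ _)
    · rw [bsig_snd]; exact decide_eq_true (mem_reach_self _ _)
  · -- the side flip
    by_cases hu' : u' = a₁
    · subst hu'
      unfold esym
      refine Finset.sum_eq_zero fun ω _ => Fsym_zero_coinc_second _ _ ?_ ?_
      · rw [rsig_snd]; exact decide_eq_true (mem_reach_self _ _)
      · rw [bsig_snd]; exact decide_eq_true (mem_reach_self _ _)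
    · have hperm : ∑ ω : E₁ → Bool, Fsym (rsig Z₁ u u' a₁ st ω) (bsig Z₁ u u' a₁ st ω) =
          ∑ ω : E₁ → Bool, Fsym (rsig Z₁ u u' a₁ st (flipT Z₁ (side Z₁ st a₁ u') ω))
            (bsig Z₁ u u' a₁ st (flipT Z₁ (side Z₁ st a₁ u') ω)) :=
        (Equiv.sum_comp (flipT_involutive Z₁ (side Z₁ st a₁ u')).toPerm
          (fun ω => Fsym (rsig Z₁ u u' a₁ st ω) (bsig Z₁ u u' a₁ st ω))).symm
      have h2 : 2 * esym Z₁ u u' a₁ st = ∑ ω : E₁ → Bool,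
          (Fsym (rsig Z₁ u u' a₁ st ω) (bsig Z₁ u u' a₁ st ω)
            + Fsym (rsig Z₁ u u' a₁ st (flipT Z₁ (side Z₁ st a₁ u') ω))
                (bsig Z₁ u u' a₁ st (flipT Z₁ (side Z₁ st a₁ u') ω))) := by
        rw [Finset.sum_add_distrib, ← hperm, esym]; ring
      rw [Finset.sum_eq_zero fun ω _ => Fsym_add_flipT Z₁ u u' a₁ hu' h ω] at h2
      omega

/-! ## Relabelling the marks -/

/-- `Fsym` is invariant under the exchange of the two exits. -/
theorem Fsym_eswap : ∀ s t : P3, Fsym (s.2.1, s.1, s.2.2) (t.2.1, t.1, t.2.2) = Fsym s t := by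
  decide

/-- `Fsym` is invariant under the exchange of the anchor with the first exit. -/
theorem Fsym_aswap : ∀ s t : P3, Fsym (s.1, s.2.2, s.2.1) (t.1, t.2.2, t.2.1) = Fsym s t := by
  decide

/-- `Fsym` is invariant under the rotation of the marks. -/
theorem Fsym_rot : ∀ s t : P3, Fsym (s.2.1, s.2.2, s.1) (t.2.1, t.2.2, t.1) = Fsym s t := by
  decide

omit [DecidableEq E₁] [Fintype E₁] in
/-- The red pattern with the exits exchanged. -/
theorem rsig_eswap' (st : E₁ → EStat) (ω : E₁ → Bool) :
    rsig Z₁ u' u a₁ st ω =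
      ((rsig Z₁ u u' a₁ st ω).2.1, (rsig Z₁ u u' a₁ st ω).1, (rsig Z₁ u u' a₁ st ω).2.2) := by
  simp only [rsig, Prod.mk.injEq, true_and]
  exact decide_eq_decide.2 ⟨RdS_symm Z₁ st ω, RdS_symm Z₁ st ω⟩

omit [DecidableEq E₁] [Fintype E₁] in
/-- The blue pattern with the exits exchanged. -/
theorem bsig_eswap' (st : E₁ → EStat) (ω : E₁ → Bool) :
    bsig Z₁ u' u a₁ st ω =
      ((bsig Z₁ u u' a₁ st ω).2.1, (bsig Z₁ u u' a₁ st ω).1, (bsig Z₁ u u' a₁ st ω).2.2) := by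
  simp only [bsig, Prod.mk.injEq, true_and]
  exact decide_eq_decide.2 ⟨MgS_symm Z₁ st ω, MgS_symm Z₁ st ω⟩

omit [DecidableEq E₁] [Fintype E₁] in
/-- The red pattern with the anchor and the first exit exchanged (anchor `u`, exits `a₁`, `u'`). -/
theorem rsig_aswap' (st : E₁ → EStat) (ω : E₁ → Bool) :
    rsig Z₁ a₁ u' u st ω =
      ((rsig Z₁ u u' a₁ st ω).1, (rsig Z₁ u u' a₁ st ω).2.2, (rsig Z₁ u u' a₁ st ω).2.1) := by
  simp only [rsig, Prod.mk.injEq, and_true]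
  exact decide_eq_decide.2 ⟨RdS_symm Z₁ st ω, RdS_symm Z₁ st ω⟩

omit [DecidableEq E₁] [Fintype E₁] in
/-- The blue pattern with the anchor and the first exit exchanged. -/
theorem bsig_aswap' (st : E₁ → EStat) (ω : E₁ → Bool) :
    bsig Z₁ a₁ u' u st ω =
      ((bsig Z₁ u u' a₁ st ω).1, (bsig Z₁ u u' a₁ st ω).2.2, (bsig Z₁ u u' a₁ st ω).2.1) := by
  simp only [bsig, Prod.mk.injEq, and_true]
  exact decide_eq_decide.2 ⟨MgS_symm Z₁ st ω, MgS_symm Z₁ st ω⟩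

omit [DecidableEq E₁] [Fintype E₁] in
/-- The red pattern with the marks rotated (anchor `u'`, exits `a₁`, `u`). -/
theorem rsig_rot' (st : E₁ → EStat) (ω : E₁ → Bool) :
    rsig Z₁ a₁ u u' st ω =
      ((rsig Z₁ u u' a₁ st ω).2.1, (rsig Z₁ u u' a₁ st ω).2.2, (rsig Z₁ u u' a₁ st ω).1) := by
  simp only [rsig, Prod.mk.injEq, and_true]
  exact ⟨decide_eq_decide.2 ⟨RdS_symm Z₁ st ω, RdS_symm Z₁ st ω⟩,
    decide_eq_decide.2 ⟨RdS_symm Z₁ st ω, RdS_symm Z₁ st ω⟩⟩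

omit [DecidableEq E₁] [Fintype E₁] in
/-- The blue pattern with the marks rotated. -/
theorem bsig_rot' (st : E₁ → EStat) (ω : E₁ → Bool) :
    bsig Z₁ a₁ u u' st ω =
      ((bsig Z₁ u u' a₁ st ω).2.1, (bsig Z₁ u u' a₁ st ω).2.2, (bsig Z₁ u u' a₁ st ω).1) := by
  simp only [bsig, Prod.mk.injEq, and_true]
  exact ⟨decide_eq_decide.2 ⟨MgS_symm Z₁ st ω, MgS_symm Z₁ st ω⟩,
    decide_eq_decide.2 ⟨MgS_symm Z₁ st ω, MgS_symm Z₁ st ω⟩⟩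

open Classical in
/-- The symmetrised excess is invariant under the exchange of the exits. -/
theorem esym_eswap (st : E₁ → EStat) : esym Z₁ u' u a₁ st = esym Z₁ u u' a₁ st := by
  unfold esym
  refine Finset.sum_congr rfl fun ω _ => ?_
  rw [rsig_eswap', bsig_eswap', Fsym_eswap]

open Classical in
/-- The symmetrised excess is invariant under the exchange of the anchor with the first exit. -/
theorem esym_aswap (st : E₁ → EStat) : esym Z₁ a₁ u' u st = esym Z₁ u u' a₁ st := by
  unfold esym
  refine Finset.sum_congr rfl fun ω _ => ?_
  rw [rsig_aswap', bsig_aswap', Fsym_aswap]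

open Classical in
/-- The symmetrised excess is invariant under the rotation of the marks. -/
theorem esym_rot (st : E₁ → EStat) : esym Z₁ a₁ u u' st = esym Z₁ u u' a₁ st := by
  unfold esym
  refine Finset.sum_congr rfl fun ω _ => ?_
  rw [rsig_rot', bsig_rot', Fsym_rot]

/-! ## THE THEOREM -/

/-- **THEOREM (SEPARABLE ⟹ THE EXCESS VANISHES), status form**: if the three marks are not all connected by present
edges, or one of them separates the other two, the symmetrised excess of the status is `0`. -/
theorem esym_eq_zero_of_separable (st : E₁ → EStat) (h : SeparableS Z₁ u u' a₁ st) : esym Z₁ u u' a₁ st = 0 := by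
  rcases h with h | h | h | h
  · exact esym_eq_zero_of_not_conn Z₁ u u' a₁ st h
  · exact esym_eq_zero_of_sep_anchor Z₁ u u' a₁ st h
  · rw [← esym_aswap]
    exact esym_eq_zero_of_sep_anchor Z₁ a₁ u' u st h
  · rw [← esym_rot]
    exact esym_eq_zero_of_sep_anchor Z₁ a₁ u u' st h

omit [DecidableEq E₁] [Fintype E₁] in
/-- With every edge free, present adjacency is the host's adjacency. -/
theorem PAdjS_free (x y : V₁) : PAdjS Z₁ (fun _ => EStat.free) x y ↔ ∃ e, Z₁.Joins e x y := by
  unfold PAdjS AdjCol presE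
  simp

/-- **THEOREM (SEPARABLE ⟹ THE EXCESS VANISHES)**: on a separable host (the marks not all connected, or one mark a
cut vertex between the other two, coincidences included) `N_RRa = N_RB + N_WRj + N_RWj`. -/
theorem excess_eq_zero_of_separable (h : SeparableS Z₁ u u' a₁ (fun _ => EStat.free)) :
    excess Z₁ u u' a₁ = 0 := by
  rw [excess_eq_excessZ Z₁ u u' a₁]
  have h2 := esym_eq_zero_of_separable Z₁ u u' a₁ _ h
  rw [esym_free_eq Z₁ u u' a₁] at h2
  have h3 : excessZ Z₁ u u' a₁ = 0 := by omega
  rw [h3, Int.cast_zero]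

end MultiExit

end ZoneZ

end PercRepro
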